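import Summits.HodgeConjecture.CorCM.AbelianCMFieldsOddPartClassification
import Mathlib.NumberTheory.Cyclotomic.Gal
import Mathlib.RingTheory.ZMod.UnitsCyclic
import HarnessLib

/-!
# Cyclotomic fields whose degree has an odd part: all simple CM abelian varieties are nondegenerate iff the
# conductor is an odd prime power or twice one AND the odd part of the degree is prime

COR-CM (cell `pub-hodgecm2`), binder seat b04 (gen 18), count-neutral claim ABELIAN-ODD-PART, part IV (cyclotomic
corollary).  KERNEL ONLY: theorems; no definition, no named fact, no `sorry`.  `HC_CM` is neither used nor claimed.

For `L = ℚ(ζ_N)`, `N ≥ 3`, the Galois group is `(ℤ/N)ˣ` (Mathlib `IsCyclotomicExtension.autEquivPow`), cyclic iff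
`N ∈ {p^k, 2p^k}` for an odd prime `p` (or `N = 4`; Mathlib `ZMod.isCyclic_units_iff`).  With part IIIb:

**Theorem (`forall_isPrimitive_isNondegenerate_iff_cyclotomic`).**  If `φ(N) = 2^{a+1} m` with `m` odd, `m ≠ 1`,
then every primitive CM type of `ℚ(ζ_N)` is nondegenerate (every simple abelian variety with CM by `ℚ(ζ_N)` is
nondegenerate, `forall_isSimple_isNondegenerate_iff_cyclotomic`) **iff `m` is prime and `N = p^k` or `2p^k` for
an odd prime `p`.**  Combined with gen 11/12 (`N = p`: odd part of `p − 1` prime or `1`; `N = p^k`, `k ≥ 2`: only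
`k = 2` with `p` a Fermat prime) this lists the cyclotomic fields of non-`2`-power degree all of whose simple CM
abelian varieties are nondegenerate: `ℚ(ζ_p)`, `ℚ(ζ_{2p})` with `p − 1 = 2^s q`, `q` prime, and `ℚ(ζ_{p²})`,
`ℚ(ζ_{2p²})` with `p` a Fermat prime — and NO conductor with two distinct odd prime factors or divisible by `4p`:
`ℚ(ζ₂₁)`, `ℚ(ζ₂₈)`, `ℚ(ζ₃₅)`, `ℚ(ζ₃₆)`, `ℚ(ζ₃₉)`, `ℚ(ζ₄₅)`, `ℚ(ζ₅₅)`, `ℚ(ζ₆₃)`, … all carry SIMPLE DEGENERATE CM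
abelian varieties of dimension `φ(N)/2` with exceptional Hodge classes (`exists_simple_degenerate_cyclotomic_*`;
the gen 11 censuses saw the `24` primitive degenerate types of `ℚ(ζ₂₁)`, `ℚ(ζ₂₈)`, `ℚ(ζ₃₆)` one conductor at a
time).

## References

* [Kubota1965] T. Kubota, *On the field extension by complex multiplication*, Trans. AMS 118 (1965), §4 Lemma 2.
* [Shimura1998] G. Shimura, *Abelian Varieties with Complex Multiplication and Modular Functions*, §6.2 Thm. 3,
  §8.2 Prop. 26.
* [Washington1997] L. C. Washington, *Introduction to Cyclotomic Fields*, Thm. 2.5 (`Gal(ℚ(ζ_N)/ℚ) ≅ (ℤ/N)ˣ`).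
* [Dodson1984] B. Dodson, *The structure of Galois groups of CM-fields*, Trans. AMS 283 (1984), §3.2.1.
-/

noncomputable section

open CategoryTheory CategoryTheory.Limits NumberField Polynomial

namespace Summit.HodgeConjecture.CorCM.AbelianOddPart

open Literature.NumberTheory.ComplexMultiplication
open Literature.AlgebraicGeometry.Motives (AbelianVariety CMType)
open Literature.AlgebraicGeometry.HodgeTheory
open Literature.AlgebraicGeometry.ComplexMultiplication (IsCMTypeRealisation isSimple_iff_isPrimitive)
open Literature.AlgebraicGeometry.Pohlmann1968
open Literature.Barriers.HodgeConjecture (divisorClassesSpan)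

open scoped Classical

/-! ## §1 `(ℤ/N)ˣ` for `N ≥ 3` -/

/-- For `N ≥ 3`, `N ≠ 4`: `(ℤ/N)ˣ` is cyclic iff `N = p^k` or `N = 2p^k` for an odd prime `p` and `k ≥ 1`
(Mathlib `ZMod.isCyclic_units_iff`). [cite: Washington1997, Thm. 2.5] -/
theorem isCyclic_units_iff_of_three_le {N : ℕ} (hN : 3 ≤ N) (h4 : N ≠ 4) :
    IsCyclic (ZMod N)ˣ ↔ ∃ p k : ℕ, p.Prime ∧ Odd p ∧ 1 ≤ k ∧ (N = p ^ k ∨ N = 2 * p ^ k) := by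
  rw [ZMod.isCyclic_units_iff N]
  constructor
  · rintro (h | h | h | h | h)
    · omega
    · omega
    · omega
    · exact absurd h h4
    · exact h
  · exact fun h => Or.inr (Or.inr (Or.inr (Or.inr h)))

/-- `(ℤ/N)ˣ` is not cyclic when `4 ∣ N` and `N ≠ 4`, `N ≠ 0` (e.g. `N = 28, 36, 52, 56`). [folklore] -/
theorem not_isCyclic_units_of_four_dvd {N : ℕ} (h4N : 4 ∣ N) (h4 : N ≠ 4) (h0 : N ≠ 0) :
    ¬ IsCyclic (ZMod N)ˣ := by
  rw [isCyclic_units_iff_of_three_le (by omega) h4]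
  rintro ⟨p, k, hp, hodd, -, h | h⟩
  · have hoddN : Odd N := by rw [h]; exact hodd.pow
    obtain ⟨r, hr⟩ := h4N
    rw [hr] at hoddN
    exact (Nat.not_even_iff_odd.2 hoddN) ⟨2 * r, by ring⟩
  · have hoddpk : Odd (p ^ k) := hodd.pow
    obtain ⟨r, hr⟩ := h4N
    have h2 : p ^ k = 2 * r := by omega
    exact (Nat.not_even_iff_odd.2 hoddpk) ⟨r, by omega⟩

/-! ## §2 Cyclotomic fields -/

section Field

variable {L : Type} [Field L] [NumberField L]

/-- **`ℚ(ζ_N)`, `N ≥ 3`: CM, Galois with commutative Galois group `≅ (ℤ/N)ˣ`, degree `φ(N)`.**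
[cite: Washington1997, Thm. 2.5] -/
theorem cyclotomic_data {N : ℕ} (hN : 3 ≤ N) (L : Type) [Field L] [NumberField L]
    [IsCyclotomicExtension {N} ℚ L] :
    IsCMField L ∧ IsGalois ℚ L ∧ (∀ g h : L ≃ₐ[ℚ] L, g * h = h * g) ∧
      (IsCyclic (L ≃ₐ[ℚ] L) ↔ IsCyclic (ZMod N)ˣ) ∧ Module.finrank ℚ L = N.totient := by
  haveI : NeZero N := ⟨by omega⟩
  have hirr : Irreducible (cyclotomic N ℚ) := cyclotomic.irreducible_rat (by omega)
  haveI := IsCyclotomicExtension.isGalois {N} ℚ L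
  set e := IsCyclotomicExtension.autEquivPow L hirr with he
  refine ⟨IsCyclotomicExtension.Rat.isCMField L (S := ({N} : Set ℕ)) ⟨N, rfl, by omega⟩, inferInstance,
    fun g h => e.injective (by rw [map_mul, map_mul, mul_comm]), e.isCyclic, IsCyclotomicExtension.finrank L hirr⟩

/-- `N ≠ 4` when `φ(N)` has an odd part `m ≠ 1`. [folklore] -/
theorem ne_four_of_totient_eq {N a m : ℕ} (hm1 : m ≠ 1) (hφ : N.totient = 2 ^ (a + 1) * m) : N ≠ 4 := by
  rintro rfl
  have h4 : Nat.totient 4 = 2 := by decide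
  rw [h4, pow_succ] at hφ
  have h1 : 1 ≤ 2 ^ a := Nat.one_le_two_pow
  have hm0 : m ≠ 0 := fun h => by rw [h, mul_zero] at hφ; exact absurd hφ (by norm_num)
  have : 2 ^ a * 2 * m ≥ 2 * m := by nlinarith
  omega

/-- **THE CYCLOTOMIC CLASSIFICATION (degrees with an odd part).**  `L = ℚ(ζ_N)`, `N ≥ 3`, `φ(N) = 2^{a+1} m`,
`m` odd, `m ≠ 1`: every PRIMITIVE CM type of `L` is nondegenerate **iff** `m` is prime and `N = p^k` or `2p^k` for
an odd prime `p`. [cite: Kubota1965, §4 Lemma 2] [cite: Washington1997, Thm. 2.5] [cite: Dodson1984, §3.2.1]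
[cite: Shimura1998, §8.2 Prop. 26] -/
theorem forall_isPrimitive_isNondegenerate_iff_cyclotomic {N a m : ℕ} (hN : 3 ≤ N) (hm : Odd m) (hm1 : m ≠ 1)
    (hφ : N.totient = 2 ^ (a + 1) * m) [IsCyclotomicExtension {N} ℚ L] (φ₀ : L →+* ℂ) :
    (∀ Φ : CMType L, IsPrimitive (ℂ ≃+* ℂ) Φ.1 φ₀ → IsNondegenerate Φ) ↔
      m.Prime ∧ ∃ p k : ℕ, p.Prime ∧ Odd p ∧ 1 ≤ k ∧ (N = p ^ k ∨ N = 2 * p ^ k) := by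
  obtain ⟨hcm, hgal, hcomm, hcyc, hfin⟩ := cyclotomic_data hN L
  haveI := hcm
  haveI := hgal
  rw [forall_isPrimitive_isNondegenerate_iff_of_ne_one hcomm hm hm1 (hfin.trans hφ) φ₀, hcyc,
    isCyclic_units_iff_of_three_le hN (ne_four_of_totient_eq hm1 hφ), and_comm]

/-- **THE CYCLOTOMIC CLASSIFICATION on simple abelian varieties**: `φ(N) = 2^{a+1} m`, `m` odd `≠ 1`: every SIMPLE
abelian variety with CM by `ℚ(ζ_N)` is nondegenerate (⟹ the Hodge conjecture for all its powers) iff `m` is prime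
and `N ∈ {p^k, 2p^k}`, `p` an odd prime. [cite: Shimura1998, §6.2 Thm. 3 and §8.2 Prop. 26] [cite: Kubota1965,
§4 Lemma 2] [cite: Washington1997, Thm. 2.5] -/
theorem forall_isSimple_isNondegenerate_iff_cyclotomic {N a m : ℕ} (hN : 3 ≤ N) (hm : Odd m) (hm1 : m ≠ 1)
    (hφ : N.totient = 2 ^ (a + 1) * m) [IsCyclotomicExtension {N} ℚ L] :
    (∀ (Φ : CMType L) (A : AbelianVariety ℂ) (ι : 𝓞 L →+* End A) (θ : L →+* Module.End ℂ (complexBetti A.X 1)),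
        IsCMTypeRealisation Φ A ι θ → A.IsSimple → IsNondegenerate Φ) ↔
      m.Prime ∧ ∃ p k : ℕ, p.Prime ∧ Odd p ∧ 1 ≤ k ∧ (N = p ^ k ∨ N = 2 * p ^ k) := by
  obtain ⟨hcm, hgal, -, -, -⟩ := cyclotomic_data hN L
  haveI := hcm
  haveI := hgal
  obtain ⟨φ₀⟩ := (inferInstance : Nonempty (L →+* ℂ))
  rw [forall_isSimple_iff_forall_isPrimitive φ₀]
  exact forall_isPrimitive_isNondegenerate_iff_cyclotomic hN hm hm1 hφ φ₀

/-- **Non-cyclic `(ℤ/N)ˣ` with an odd part in `φ(N)` ⟹ SIMPLE DEGENERATE CM abelian varieties of dimension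
`φ(N)/2 = 2^a m` with CM by `ℚ(ζ_N)`**, carrying an exceptional Hodge class (rational, of type `(k,k)`, outside the
complexified divisor ring) on some power. [cite: Shimura1998, §6.2 Thm. 3 and §8.2 Prop. 26] [cite: Kubota1965,
§4 Lemma 2] [cite: Washington1997, Thm. 2.5] -/
theorem exists_simple_degenerate_cyclotomic_of_not_isCyclic {N a m : ℕ} (hN : 3 ≤ N) (hm : Odd m) (hm1 : m ≠ 1)
    (hφ : N.totient = 2 ^ (a + 1) * m) (hnc : ¬ IsCyclic (ZMod N)ˣ) [IsCyclotomicExtension {N} ℚ L] :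
    ∃ (Φ : CMType L) (φ₀ : L →+* ℂ) (A : AbelianVariety ℂ) (ι : 𝓞 L →+* End A)
      (θ : L →+* Module.End ℂ (complexBetti A.X 1)),
      IsPrimitive (ℂ ≃+* ℂ) Φ.1 φ₀ ∧ ¬ IsNondegenerate Φ ∧ IsCMTypeRealisation Φ A ι θ ∧ A.IsSimple ∧
      A.dim = 2 ^ a * m ∧
      ∃ M k : ℕ, ∃ x : complexBetti (⨁ fun _ : Fin M => A).X (2 * k), IsRationalClass x ∧
        IsOfHodgeType (⨁ fun _ : Fin M => A).dim (⨁ fun _ : Fin M => A).X (2 * k) k k x ∧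
        x ∉ divisorClassesSpan (⨁ fun _ : Fin M => A).X (⨁ fun _ : Fin M => A).dim k := by
  obtain ⟨hcm, hgal, hcomm, hcyc, hfin⟩ := cyclotomic_data hN L
  haveI := hcm
  haveI := hgal
  exact exists_simple_degenerate_of_not_isCyclic hcomm hm hm1 (hfin.trans hφ) (fun h => hnc (hcyc.1 h))

/-! ## §3 Instances: conductors with two odd prime factors, or divisible by `4p` -/

/-- **`ℚ(ζ₂₁)`** (`φ = 12 = 2²·3`, `(ℤ/21)ˣ ≅ ℤ/2 × ℤ/6`): simple DEGENERATE CM sixfolds with exceptional Hodge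
classes exist (the `24` primitive degenerate types of gen 11's census). [cite: Shimura1998, §6.2 Thm. 3]
[cite: Kubota1965, §4 Lemma 2] -/
theorem exists_simple_degenerate_cyclotomic_twentyOne [IsCyclotomicExtension {21} ℚ L] :
    ∃ (Φ : CMType L) (φ₀ : L →+* ℂ) (A : AbelianVariety ℂ) (ι : 𝓞 L →+* End A)
      (θ : L →+* Module.End ℂ (complexBetti A.X 1)),
      IsPrimitive (ℂ ≃+* ℂ) Φ.1 φ₀ ∧ ¬ IsNondegenerate Φ ∧ IsCMTypeRealisation Φ A ι θ ∧ A.IsSimple ∧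
      A.dim = 2 ^ 1 * 3 ∧
      ∃ M k : ℕ, ∃ x : complexBetti (⨁ fun _ : Fin M => A).X (2 * k), IsRationalClass x ∧
        IsOfHodgeType (⨁ fun _ : Fin M => A).dim (⨁ fun _ : Fin M => A).X (2 * k) k k x ∧
        x ∉ divisorClassesSpan (⨁ fun _ : Fin M => A).X (⨁ fun _ : Fin M => A).dim k :=
  exists_simple_degenerate_cyclotomic_of_not_isCyclic (N := 21) (by norm_num) (by decide) (by norm_num)
    (by decide) (ZMod.not_isCyclic_units_of_mul_coprime 3 7 (by decide) (by norm_num) (by decide) (by norm_num)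
      (by norm_num))

/-- **`ℚ(ζ₂₈)`** (`φ = 12`, `(ℤ/28)ˣ ≅ ℤ/2 × ℤ/6`): simple degenerate CM sixfolds with exceptional classes exist.
[cite: Shimura1998, §6.2 Thm. 3] [cite: Kubota1965, §4 Lemma 2] -/
theorem exists_simple_degenerate_cyclotomic_twentyEight [IsCyclotomicExtension {28} ℚ L] :
    ∃ (Φ : CMType L) (φ₀ : L →+* ℂ) (A : AbelianVariety ℂ) (ι : 𝓞 L →+* End A)
      (θ : L →+* Module.End ℂ (complexBetti A.X 1)),
      IsPrimitive (ℂ ≃+* ℂ) Φ.1 φ₀ ∧ ¬ IsNondegenerate Φ ∧ IsCMTypeRealisation Φ A ι θ ∧ A.IsSimple ∧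
      A.dim = 2 ^ 1 * 3 ∧
      ∃ M k : ℕ, ∃ x : complexBetti (⨁ fun _ : Fin M => A).X (2 * k), IsRationalClass x ∧
        IsOfHodgeType (⨁ fun _ : Fin M => A).dim (⨁ fun _ : Fin M => A).X (2 * k) k k x ∧
        x ∉ divisorClassesSpan (⨁ fun _ : Fin M => A).X (⨁ fun _ : Fin M => A).dim k :=
  exists_simple_degenerate_cyclotomic_of_not_isCyclic (N := 28) (by norm_num) (by decide) (by norm_num)
    (by decide) (not_isCyclic_units_of_four_dvd (by norm_num) (by norm_num) (by norm_num))

/-- **`ℚ(ζ₃₆)`** (`φ = 12`, `(ℤ/36)ˣ ≅ ℤ/2 × ℤ/6`): simple degenerate CM sixfolds with exceptional classes exist.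
[cite: Shimura1998, §6.2 Thm. 3] [cite: Kubota1965, §4 Lemma 2] -/
theorem exists_simple_degenerate_cyclotomic_thirtySix [IsCyclotomicExtension {36} ℚ L] :
    ∃ (Φ : CMType L) (φ₀ : L →+* ℂ) (A : AbelianVariety ℂ) (ι : 𝓞 L →+* End A)
      (θ : L →+* Module.End ℂ (complexBetti A.X 1)),
      IsPrimitive (ℂ ≃+* ℂ) Φ.1 φ₀ ∧ ¬ IsNondegenerate Φ ∧ IsCMTypeRealisation Φ A ι θ ∧ A.IsSimple ∧
      A.dim = 2 ^ 1 * 3 ∧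
      ∃ M k : ℕ, ∃ x : complexBetti (⨁ fun _ : Fin M => A).X (2 * k), IsRationalClass x ∧
        IsOfHodgeType (⨁ fun _ : Fin M => A).dim (⨁ fun _ : Fin M => A).X (2 * k) k k x ∧
        x ∉ divisorClassesSpan (⨁ fun _ : Fin M => A).X (⨁ fun _ : Fin M => A).dim k :=
  exists_simple_degenerate_cyclotomic_of_not_isCyclic (N := 36) (by norm_num) (by decide) (by norm_num)
    (by decide) (not_isCyclic_units_of_four_dvd (by norm_num) (by norm_num) (by norm_num))

/-- **`ℚ(ζ₃₅)`** (`φ = 24 = 2³·3`, `(ℤ/35)ˣ ≅ ℤ/2 × ℤ/12`): simple degenerate CM `12`-folds with exceptional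
classes exist. [cite: Shimura1998, §6.2 Thm. 3] [cite: Kubota1965, §4 Lemma 2] -/
theorem exists_simple_degenerate_cyclotomic_thirtyFive [IsCyclotomicExtension {35} ℚ L] :
    ∃ (Φ : CMType L) (φ₀ : L →+* ℂ) (A : AbelianVariety ℂ) (ι : 𝓞 L →+* End A)
      (θ : L →+* Module.End ℂ (complexBetti A.X 1)),
      IsPrimitive (ℂ ≃+* ℂ) Φ.1 φ₀ ∧ ¬ IsNondegenerate Φ ∧ IsCMTypeRealisation Φ A ι θ ∧ A.IsSimple ∧
      A.dim = 2 ^ 2 * 3 ∧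
      ∃ M k : ℕ, ∃ x : complexBetti (⨁ fun _ : Fin M => A).X (2 * k), IsRationalClass x ∧
        IsOfHodgeType (⨁ fun _ : Fin M => A).dim (⨁ fun _ : Fin M => A).X (2 * k) k k x ∧
        x ∉ divisorClassesSpan (⨁ fun _ : Fin M => A).X (⨁ fun _ : Fin M => A).dim k :=
  exists_simple_degenerate_cyclotomic_of_not_isCyclic (N := 35) (by norm_num) (by decide) (by norm_num)
    (by decide) (ZMod.not_isCyclic_units_of_mul_coprime 5 7 (by decide) (by norm_num) (by decide) (by norm_num)
      (by norm_num))

/-- **`ℚ(ζ₄₅)`** (`φ = 24`, `(ℤ/45)ˣ ≅ ℤ/2 × ℤ/12`): simple degenerate CM `12`-folds with exceptional classes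
exist. [cite: Shimura1998, §6.2 Thm. 3] [cite: Kubota1965, §4 Lemma 2] -/
theorem exists_simple_degenerate_cyclotomic_fortyFive [IsCyclotomicExtension {45} ℚ L] :
    ∃ (Φ : CMType L) (φ₀ : L →+* ℂ) (A : AbelianVariety ℂ) (ι : 𝓞 L →+* End A)
      (θ : L →+* Module.End ℂ (complexBetti A.X 1)),
      IsPrimitive (ℂ ≃+* ℂ) Φ.1 φ₀ ∧ ¬ IsNondegenerate Φ ∧ IsCMTypeRealisation Φ A ι θ ∧ A.IsSimple ∧
      A.dim = 2 ^ 2 * 3 ∧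
      ∃ M k : ℕ, ∃ x : complexBetti (⨁ fun _ : Fin M => A).X (2 * k), IsRationalClass x ∧
        IsOfHodgeType (⨁ fun _ : Fin M => A).dim (⨁ fun _ : Fin M => A).X (2 * k) k k x ∧
        x ∉ divisorClassesSpan (⨁ fun _ : Fin M => A).X (⨁ fun _ : Fin M => A).dim k :=
  exists_simple_degenerate_cyclotomic_of_not_isCyclic (N := 45) (by norm_num) (by decide) (by norm_num)
    (by decide) (ZMod.not_isCyclic_units_of_mul_coprime 9 5 (by decide) (by norm_num) (by decide) (by norm_num)
      (by norm_num))

/-- **`ℚ(ζ₅₅)`** (`φ = 40 = 2³·5`, `(ℤ/55)ˣ ≅ ℤ/2 × ℤ/20`): simple degenerate CM `20`-folds with exceptional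
classes exist. [cite: Shimura1998, §6.2 Thm. 3] [cite: Kubota1965, §4 Lemma 2] -/
theorem exists_simple_degenerate_cyclotomic_fiftyFive [IsCyclotomicExtension {55} ℚ L] :
    ∃ (Φ : CMType L) (φ₀ : L →+* ℂ) (A : AbelianVariety ℂ) (ι : 𝓞 L →+* End A)
      (θ : L →+* Module.End ℂ (complexBetti A.X 1)),
      IsPrimitive (ℂ ≃+* ℂ) Φ.1 φ₀ ∧ ¬ IsNondegenerate Φ ∧ IsCMTypeRealisation Φ A ι θ ∧ A.IsSimple ∧
      A.dim = 2 ^ 2 * 5 ∧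
      ∃ M k : ℕ, ∃ x : complexBetti (⨁ fun _ : Fin M => A).X (2 * k), IsRationalClass x ∧
        IsOfHodgeType (⨁ fun _ : Fin M => A).dim (⨁ fun _ : Fin M => A).X (2 * k) k k x ∧
        x ∉ divisorClassesSpan (⨁ fun _ : Fin M => A).X (⨁ fun _ : Fin M => A).dim k :=
  exists_simple_degenerate_cyclotomic_of_not_isCyclic (N := 55) (by norm_num) (by decide) (by norm_num)
    (by decide) (ZMod.not_isCyclic_units_of_mul_coprime 5 11 (by decide) (by norm_num) (by decide) (by norm_num)
      (by norm_num))

/-- **`ℚ(ζ₆₃)`** (`φ = 36 = 2²·9`, `(ℤ/63)ˣ ≅ ℤ/6 × ℤ/6`): simple degenerate CM `18`-folds with exceptional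
classes exist (here both mechanisms occur: `m = 9` composite AND the group non-cyclic).
[cite: Shimura1998, §6.2 Thm. 3] [cite: Kubota1965, §4 Lemma 2] -/
theorem exists_simple_degenerate_cyclotomic_sixtyThree [IsCyclotomicExtension {63} ℚ L] :
    ∃ (Φ : CMType L) (φ₀ : L →+* ℂ) (A : AbelianVariety ℂ) (ι : 𝓞 L →+* End A)
      (θ : L →+* Module.End ℂ (complexBetti A.X 1)),
      IsPrimitive (ℂ ≃+* ℂ) Φ.1 φ₀ ∧ ¬ IsNondegenerate Φ ∧ IsCMTypeRealisation Φ A ι θ ∧ A.IsSimple ∧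
      A.dim = 2 ^ 1 * 9 ∧
      ∃ M k : ℕ, ∃ x : complexBetti (⨁ fun _ : Fin M => A).X (2 * k), IsRationalClass x ∧
        IsOfHodgeType (⨁ fun _ : Fin M => A).dim (⨁ fun _ : Fin M => A).X (2 * k) k k x ∧
        x ∉ divisorClassesSpan (⨁ fun _ : Fin M => A).X (⨁ fun _ : Fin M => A).dim k :=
  exists_simple_degenerate_cyclotomic_of_not_isCyclic (N := 63) (by norm_num) (by decide) (by norm_num)
    (by decide) (ZMod.not_isCyclic_units_of_mul_coprime 9 7 (by decide) (by norm_num) (by decide) (by norm_num)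
      (by norm_num))

end Field

end Summit.HodgeConjecture.CorCM.AbelianOddPart

end
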